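import Literature.RingTheory.MvPolynomial.HilbertFunctionBounds
import Literature.RingTheory.KrullDimension.TranscendenceDegreeOfPoint
import Literature.Computability.AlgebraicComplexity.MS21DenseOrbitsHittingSets
import Literature.Computability.AlgebraicComplexity.OrbitClosure
import Mathlib.RingTheory.Nullstellensatz
import Mathlib.Algebra.MvPolynomial.Funext
import Mathlib.Algebra.MvPolynomial.Equiv
import Mathlib.FieldTheory.RatFunc.AsPolynomial
import Mathlib.RingTheory.AlgebraicIndependent.TranscendenceBasis
import HarnessLib

/-!
# Hitting sets EXIST for the BORDER of every polynomially parametrised class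
# (Heintz–Schnorr 1980, Basic Thm. 3.2 / Thm. 4.4 — existence half, as reworded by
# Chatterjee–Kumar–Ramya–Saptharishi–Tengse 2020, arXiv v4 §3.1, Thms. 3.2–3.3)

Topic: `Literature/Computability/AlgebraicComplexity` (theorem-only file; no named facts).

**Theorem (`BorderHittingSets.exists_hittingSet_border`).** Let `K` be a field of characteristic
`0` and let a class `𝒞` of `n`-variate polynomials be given by finitely many GENERIC MEMBERS
`𝒢_j ∈ K[y_i : i ∈ ι][x_1, …, x_n]`: over a `K`-algebra `L` the members of `𝒞_L` are the
specialisations `𝒢_j(α)`, `α ∈ L^ι` (`IsMember`; every syntactic circuit class with `#ι` field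
constants — `Σ^{[k]}Π^{[d]}Σ`, `Σ∧Σ`, `Σ^{[k]}ΠΣ∧`, sparse depth-4 normal forms, size-`s` circuits via a
universal circuit — is of this shape, the `𝒢_j` having INTEGER coefficients). Then there is a set
`H ⊆ K^n` of at most `#ι + 1` points which HITS THE BORDER of `𝒞`: every non-zero `f ∈ K[x]` with
`g = f + ε·Q ∈ 𝒞_{K(ε)}` for some `Q ∈ K[ε][x]` (the tree's `MS2021.IsEpsApprox f g`, as in
`DDS2021.border`) satisfies `f(x) ≠ 0` for some `x ∈ H`. (`K` infinite suffices and is what is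
assumed.)

Printed sources. Heintz–Schnorr [HS80, Basic Thm. 3.2 and Thm. 4.4], in the rewording of
[CKRST20, arXiv v4, Thm. 3.2 p. 25]: "Suppose that there is a polynomial map `Q : ℂ^m → ℂ^N`
given by polynomials `{Q_e}`, such that for each `f(x) ∈ 𝒞`, there exists an `α ∈ ℂ^m`, so that
`f(x) = Σ_e Q_e(α)·x^e`. Then for `W ⊆ ℂ^N` being the closure of the set of coefficient vectors
of `𝒞`, we have that: • The dimension, `dim W ≤ m`. • The degree, `deg(W) ≤ (deg Q)^{dim W}`",
and [CKRST20, Thm. 3.3 p. 25 = "Rewording of [HS80a, Theorem 4.4]"]: "for `b = deg(Q)·(d+1)²`,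
and `t = 10·dim(W)`, there exists a set of `t` points `{a_1, …, a_t} ⊆ [b]^n` that is a hitting
set for `𝒞`" (the proof, p. 26, bounds the variety of bad sequences for the CLOSURE `W`).
WHAT IS PROVED HERE: the dimension bullet and the existence of a hitting set for the whole
`K`-zero set of the ideal of `W` — hence for the border — with `dim W ≤ #ι + 1` points (better
than the printed `10·dim W`), over any infinite field. WHAT IS NOT: the degree
bullet of Thm. 3.2 and the coordinate bound `[b]^n` of Thm. 3.3/4.4 (bit complexity), whose proofs
need Bézout's inequality for `W`; the tree's `HittingSetsExist.lean`
(`HittingSets.exists_hittingSet`, zero-pattern counting) gives grid points but only hits the IMAGE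
`𝒞`, not its closure — the border is exactly what it cannot reach, and what this file adds.

## The proof (prime avoidance on the cone over `W`; no degrees)

* The CONE PRIME `𝔓_j = ker (X_e ↦ Q_{j,e}(y)·T) ⊆ S = K[X_e : e]` (`conePrime`; `T` a scaling
  variable) is a homogeneous prime (`conePrime_isHomogeneous`: a form of degree `m` goes to
  `(·)·T^m`, `aeval_monomial_one_of_isHomogeneous`) with `dim S/𝔓_j = trdeg_K` of the image
  `≤ trdeg_K K[y][T] = #ι + 1` (`ringKrullDim_quotient_conePrime_le`, via
  `Literature.RingTheory.KrullDimension.ringKrullDim_eq_toNat_trdeg_range_of_injective`,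
  Matsumura Thm 5.6).
* BORDER ⊆ `V_K(𝔓_j)` (`mem_zeroLocus_conePrime_of_isEpsApprox`; `V_K` = Mathlib's
  `MvPolynomial.zeroLocus K`): a relation `P ∈ 𝔓_j` holds identically in
  `(T, y)`, hence at `T = 1`, `y = α(ε)`: `P(coeff g) = 0` in `K(ε)`; the coefficients of `g` lie
  in `K[ε]` and `P` has constant coefficients, so `P` of their constant terms — `coeff f` — is `0`.
* CUTTING (`cut_family`, the heart of [HS80]'s argument with the counting replaced by prime
  avoidance): for a finite family of homogeneous primes of dimension `≤ a`, `a` linear forms from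
  any RICH family kill all their `K`-zeros — cut every live prime (one with a non-zero `K`-zero) by
  a form outside it; the minimal primes of `𝔓 + (ℓ)` are homogeneous of dimension one less
  (`Literature.RingTheory.MvPolynomial.ringKrullDim_quotient_add_one_of_mem_minimalPrimes_sup_span`,
  Krull's Hauptidealsatz + catenarity) and carry every `K`-zero of `𝔓` killed by `ℓ`; a
  homogeneous prime of dimension `≤ 0` contains all variables
  (`Literature.RingTheory.MvPolynomial.exists_X_pow_mem_of_ringKrullDim_le_zero`).
* RICHNESS of the evaluation forms `e_x = Σ_e x^e X_e`, `x ∈ K^n` (`evalForm_rich`): `e_x ∈ 𝔮`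
  forces `f_𝔮(x) = 0` for the polynomial `f_𝔮 ≠ 0` of a non-zero `K`-zero of `𝔮`; a non-root `x`
  of `∏_𝔮 f_𝔮` exists over an infinite field (Mathlib `MvPolynomial.funext`). ([HS80] count the
  bad `x` in a grid by Bézout and Schwartz–Zippel instead; that is where the coordinate bound and
  the degree bullet enter, and why they are not needed for bare existence.)

**The Zariski closure, verbatim (`BorderHittingSets.exists_hittingSet_zariskiClosure`).** The same
`#ι + 1` points hit every non-zero `f ∈ K[x]` whose coefficient vector lies in the ZARISKI CLOSURE
(the tree's `zariskiClosure` / `coeffVec`, `OrbitClosure.lean`) of the coefficient vectors of the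
members over `K` itself — [HS80, Thm. 4.4] / [CKRST20, Thm. 3.2] as printed ("`W ⊆ ℂ^N` … the
closure of the set of coefficient vectors of `𝒞`"): a relation `P ∈ 𝔓_j` gives `P(Q_j(β)) = 0`
for every `β ∈ K^ι` (`T = 1`, `y = β`), so `P`, read in the coefficient coordinates, vanishes on
the members of the piece `j` and hence on their Zariski closure
(`mem_zeroLocus_conePrime_of_mem_zariskiClosure`); the closure of the finite union over the pieces
is the union of the closures (product of test polynomials). This is the form consumed by the
tree's closure notions `approxComplexity` (BLMW 2011 Def. 9.3.1, Zariski closure in coefficient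
space) and — through `coeffVec_mem_zariskiClosure_of_borderComplexity_le`
(`BorderComplexityZariski.lean`) — `borderComplexity` (Bürgisser 2004 Def. 2.1).

Consumers: the existence-only renderings of the PIT theorems of Dutta–Dwivedi–Saxena 2021
(`DDS21BorderDepthThree.lean`, facts `DDS2021_thm_4_1/_4_3/_4_4/_6_6/_6_8`, typed "WEAKER than
print (explicitness dropped)"), discharged in `DDS21BorderPITExistenceProofs.lean`; hitting sets
for `\overline{VP}`-type slices in the natural-proofs files. Honest framing: a 1980 existence
theorem formalised; nothing here is explicit or algorithmic, and nothing bears on VP versus VNP.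

## References

* [HeintzSchnorr1980] J. Heintz, C.-P. Schnorr, *Testing polynomials which are easy to compute*,
  STOC 1980, 262–272 (and L'Enseignement Math. 30, 1982): Basic Thm. 3.2, Thm. 4.4.
* [ChatterjeeKumarRamyaSaptharishiTengse2020] P. Chatterjee, M. Kumar, C. Ramya, R. Saptharishi,
  A. Tengse, *On the existence of algebraically natural proofs*, arXiv:2004.14147v4, §3.1,
  Thm. 3.2 ("Rewording of [HS80a, Basic Theorem 3.2]"), Thm. 3.3 ("Rewording of [HS80a,
  Theorem 4.4]"); locator: held text HOME/lit/pdftxt/CKRST2020 p025–p027.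
* [Matsumura1987] H. Matsumura, *Commutative Ring Theory*, Thm 5.6 (`dim = trdeg`).
* [DuttaDwivediSaxena2022] P. Dutta, P. Dwivedi, N. Saxena, *Demystifying the border of depth-3
  algebraic circuits*, FOCS 2021, Def. 2.1 (the `ε`-border).
-/

noncomputable section

open MvPolynomial

attribute [local instance] MvPolynomial.gradedAlgebra

namespace Literature.Computability.AlgebraicComplexity

namespace BorderHittingSets

open Literature.RingTheory.MvPolynomial

variable {K : Type*} [Field K] {N : ℕ}

/-! ## `K`-zeros of ideals of the coefficient ring (Mathlib `MvPolynomial.zeroLocus K`) -/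

/-- A `K`-zero of `I` at which `q` vanishes is a `K`-zero of some minimal prime of `I + (q)`.
[folklore] -/
private theorem exists_minimalPrimes_mem_zeroLocus {I : Ideal (MvPolynomial (Fin N) K)}
    {v : Fin N → K} (hv : v ∈ MvPolynomial.zeroLocus K I) {q : MvPolynomial (Fin N) K}
    (hq : eval v q = 0) :
    ∃ 𝔮 ∈ (I ⊔ Ideal.span {q}).minimalPrimes, v ∈ MvPolynomial.zeroLocus K 𝔮 := by
  set M : Ideal (MvPolynomial (Fin N) K) := RingHom.ker (eval v) with hM
  haveI : M.IsPrime := RingHom.ker_isPrime _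
  have hle : I ⊔ Ideal.span {q} ≤ M := by
    refine sup_le (fun p hp => ?_) ((Ideal.span_singleton_le_iff_mem _).mpr ?_)
    · rw [hM, RingHom.mem_ker, ← coe_aeval_eq_eval]; exact hv p hp
    · rw [hM, RingHom.mem_ker]; exact hq
  obtain ⟨𝔮, h𝔮, h𝔮M⟩ := Ideal.exists_minimalPrimes_le hle
  exact ⟨𝔮, h𝔮, fun p hp => by
    have := h𝔮M hp; rwa [hM, RingHom.mem_ker, ← coe_aeval_eq_eval] at this⟩

/-- A homogeneous prime `𝔓` with `dim S/𝔓 ≤ 0` contains every variable, so its only `K`-zero is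
`0`. [folklore] -/
private theorem eq_zero_of_mem_zeroLocus_of_ringKrullDim_le_zero
    {𝔓 : Ideal (MvPolynomial (Fin N) K)} [𝔓.IsPrime]
    (h𝔓 : 𝔓.IsHomogeneous (homogeneousSubmodule (Fin N) K))
    (hdim : ringKrullDim (MvPolynomial (Fin N) K ⧸ 𝔓) ≤ 0) {v : Fin N → K}
    (hv : v ∈ MvPolynomial.zeroLocus K 𝔓) : v = 0 := by
  funext i
  obtain ⟨k, hk⟩ := exists_X_pow_mem_of_ringKrullDim_le_zero h𝔓 hdim i
  have hX : (X i : MvPolynomial (Fin N) K) ∈ 𝔓 := Ideal.IsPrime.mem_of_pow_mem inferInstance k hk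
  have := hv _ hX
  rwa [aeval_X] at this

/-! ## The simultaneous cutting lemma -/

section Cut

variable {G : Type*} (e : G → MvPolynomial (Fin N) K)

/-- **Simultaneous cutting of a finite family of homogeneous primes by linear forms from a rich
family.** Let `e : G → S_1` be a family of linear forms of `S = K[X_0, …, X_{N-1}]` which is RICH:
every finite family of ideals, each having a non-zero `K`-zero, is simultaneously avoided by some
`e g`. Then for every finite family `𝓟` of homogeneous primes with `dim S/𝔓 ≤ a` there are at most
`a` members `g_1, …, g_a` of `G` such that the only `K`-zero of any `𝔓 ∈ 𝓟` killed by all the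
`e g_j` is `0`. (Induction on `a`: a live prime is cut by a form outside it, its children — the
minimal primes of `𝔓 + (e g)` — are homogeneous of dimension one less, and a `K`-zero killed by
`e g` lies on a child; a prime of dimension `≤ 0` contains all the variables.) This is the
prime-avoidance core of Heintz–Schnorr's existence argument, with no degree bookkeeping (the number
of cuts is bounded by the dimension alone). [cite: HeintzSchnorr1980, Thm. 4.4 (proof)] -/
theorem cut_family (he : ∀ g, (e g).IsHomogeneous 1)
    (rich : ∀ 𝓠 : Finset (Ideal (MvPolynomial (Fin N) K)),
      (∀ 𝔮 ∈ 𝓠, ∃ v, v ≠ 0 ∧ v ∈ MvPolynomial.zeroLocus K 𝔮) → ∃ g, ∀ 𝔮 ∈ 𝓠, e g ∉ 𝔮) :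
    ∀ (a : ℕ) (𝓟 : Finset (Ideal (MvPolynomial (Fin N) K))),
      (∀ 𝔓 ∈ 𝓟, 𝔓.IsPrime ∧ 𝔓.IsHomogeneous (homogeneousSubmodule (Fin N) K) ∧
        ringKrullDim (MvPolynomial (Fin N) K ⧸ 𝔓) ≤ a) →
      ∃ pts : Finset G, pts.card ≤ a ∧
        ∀ 𝔓 ∈ 𝓟, ∀ v ∈ MvPolynomial.zeroLocus K 𝔓, (∀ g ∈ pts, eval v (e g) = 0) → v = 0 := by
  classical
  intro a
  induction a with
  | zero =>
    intro 𝓟 h𝓟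
    refine ⟨∅, le_rfl, fun 𝔓 h𝔓 v hv _ => ?_⟩
    obtain ⟨hprime, hhom, hdim⟩ := h𝓟 𝔓 h𝔓
    haveI := hprime
    exact eq_zero_of_mem_zeroLocus_of_ringKrullDim_le_zero hhom (by exact_mod_cast hdim) hv
  | succ a ih =>
    intro 𝓟 h𝓟
    -- the live primes: those with a non-zero `K`-zero
    set 𝓠 := 𝓟.filter fun 𝔓 => ∃ v, v ≠ 0 ∧ v ∈ MvPolynomial.zeroLocus K 𝔓 with h𝓠
    obtain ⟨g, hg⟩ := rich 𝓠 fun 𝔮 h𝔮 => (Finset.mem_filter.mp h𝔮).2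
    -- the children
    set 𝓟' : Finset (Ideal (MvPolynomial (Fin N) K)) := 𝓠.biUnion fun 𝔓 =>
      (Ideal.finite_minimalPrimes_of_isNoetherianRing _ (𝔓 ⊔ Ideal.span {e g})).toFinset with h𝓟'
    have hmem𝓟' : ∀ 𝔮, 𝔮 ∈ 𝓟' ↔ ∃ 𝔓 ∈ 𝓠, 𝔮 ∈ (𝔓 ⊔ Ideal.span {e g}).minimalPrimes := by
      intro 𝔮
      rw [h𝓟', Finset.mem_biUnion]
      simp only [Set.Finite.mem_toFinset]
    have h𝓟'prop : ∀ 𝔮 ∈ 𝓟', 𝔮.IsPrime ∧ 𝔮.IsHomogeneous (homogeneousSubmodule (Fin N) K) ∧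
        ringKrullDim (MvPolynomial (Fin N) K ⧸ 𝔮) ≤ a := by
      intro 𝔮 h𝔮
      obtain ⟨𝔓, h𝔓𝓠, hmin⟩ := (hmem𝓟' 𝔮).mp h𝔮
      have h𝔓𝓟 : 𝔓 ∈ 𝓟 := (Finset.mem_filter.mp h𝔓𝓠).1
      obtain ⟨hprime, hhom, hdim⟩ := h𝓟 𝔓 h𝔓𝓟
      haveI := hprime
      refine ⟨hmin.1.1, isHomogeneous_of_mem_minimalPrimes (hhom.sup (isHomogeneous_span_singleton
        (he g))) hmin, ?_⟩
      have hdrop := ringKrullDim_quotient_add_one_of_mem_minimalPrimes_sup_span (hg 𝔓 h𝔓𝓠) hmin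
      -- `dim S/𝔮 + 1 = dim S/𝔓 ≤ a + 1`
      have hle : ringKrullDim (MvPolynomial (Fin N) K ⧸ 𝔮) + 1 ≤ (a : WithBot ℕ∞) + 1 := by
        rw [hdrop]; exact_mod_cast hdim
      exact ENat.WithBot.add_le_add_one_right_iff.mp hle
    obtain ⟨pts', hcard', hkill'⟩ := ih 𝓟' h𝓟'prop
    refine ⟨insert g pts', (Finset.card_insert_le _ _).trans (by omega), ?_⟩
    intro 𝔓 h𝔓 v hv hev
    by_cases hlive : ∃ w, w ≠ 0 ∧ w ∈ MvPolynomial.zeroLocus K 𝔓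
    · have h𝔓𝓠 : 𝔓 ∈ 𝓠 := Finset.mem_filter.mpr ⟨h𝔓, hlive⟩
      obtain ⟨𝔮, hmin, h𝔮v⟩ :=
        exists_minimalPrimes_mem_zeroLocus hv (hev g (Finset.mem_insert_self _ _))
      exact hkill' 𝔮 ((hmem𝓟' 𝔮).mpr ⟨𝔓, h𝔓𝓠, hmin⟩) v h𝔮v
        fun g' hg' => hev g' (Finset.mem_insert_of_mem hg')
    · by_contra hv0
      exact hlive ⟨v, hv0, hv⟩

end Cut

/-! ## Evaluation forms are a rich family -/

section EvalForms

variable {n : ℕ} (mon : Fin N → (Fin n →₀ ℕ))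

/-- The evaluation form at `x ∈ K^n`: the linear form `Σ_i x^{mon i} · X_i` on coefficient space
(the hyperplane of coefficient vectors of polynomials vanishing at `x`; "a sequence `a_1, …, a_t` is
bad, if there is a nonzero polynomial `f ∈ 𝒞` satisfying `f(a_1) = ⋯ = f(a_t) = 0`").
[cite: ChatterjeeKumarRamyaSaptharishiTengse2020, Thm. 3.3 (proof, arXiv v4 p. 26)] -/
def evalForm (x : Fin n → K) : MvPolynomial (Fin N) K :=
  ∑ i, C (eval x (monomial (mon i) (1 : K))) * X i

/-- The polynomial `Σ_i v_i x^{mon i}` with coefficient vector `v` (on the monomials `mon i`)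
("`f(x) = Σ_e Q_e(α)·x^e`", read at a coefficient vector). [cite: ChatterjeeKumarRamyaSaptharishiTengse2020, Thm. 3.2 (arXiv v4 §3.1, p. 25)] -/
def toPoly (v : Fin N → K) : MvPolynomial (Fin n) K :=
  ∑ i, monomial (mon i) (v i)

/-- Evaluation forms are linear forms. [folklore] -/
private theorem evalForm_isHomogeneous (x : Fin n → K) : (evalForm mon x).IsHomogeneous 1 := by
  unfold evalForm
  refine IsHomogeneous.sum _ _ _ fun i _ => ?_
  simpa using (isHomogeneous_C _ _).mul (isHomogeneous_X K i)

/-- `e_x(v) = (toPoly v)(x)`. [folklore] -/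
private theorem eval_evalForm (x : Fin n → K) (v : Fin N → K) :
    eval v (evalForm mon x) = eval x (toPoly mon v) := by
  unfold evalForm toPoly
  simp only [map_sum, map_mul, eval_C, eval_X, eval_monomial]
  refine Finset.sum_congr rfl fun i _ => ?_
  ring

variable {mon}

/-- The coefficients of `toPoly v` are the entries of `v` (for `mon` injective). [folklore] -/
private theorem coeff_toPoly (hmon : Function.Injective mon) (v : Fin N → K) (i : Fin N) :
    coeff (mon i) (toPoly mon v) = v i := by
  classical
  unfold toPoly
  rw [coeff_sum]
  simp only [coeff_monomial]
  rw [Finset.sum_eq_single i]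
  · simp
  · intro j _ hji
    rw [if_neg]
    exact fun h => hji (hmon h)
  · intro h; exact absurd (Finset.mem_univ i) h

/-- `toPoly v` has no monomials outside the range of `mon`. [folklore] -/
private theorem coeff_toPoly_of_notMem (v : Fin N → K) {μ : Fin n →₀ ℕ} (hμ : μ ∉ Set.range mon) :
    coeff μ (toPoly mon v) = 0 := by
  classical
  unfold toPoly
  rw [coeff_sum]
  refine Finset.sum_eq_zero fun i _ => ?_
  rw [coeff_monomial, if_neg]
  exact fun h => hμ ⟨i, h⟩

/-- `toPoly v = 0 ↔ v = 0` (for `mon` injective). [folklore] -/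
private theorem toPoly_eq_zero_iff (hmon : Function.Injective mon) {v : Fin N → K} :
    toPoly mon v = 0 ↔ v = 0 := by
  constructor
  · intro h
    funext i
    have := coeff_toPoly hmon v i
    rw [h, coeff_zero] at this
    exact this.symm
  · rintro rfl
    unfold toPoly
    simp

/-- **Richness of the evaluation forms** (`K` infinite): finitely many ideals, each with a non-zero
`K`-zero `w_𝔮`, are simultaneously avoided by some `e_x` — take `x` with `∏_𝔮 (toPoly w_𝔮)(x) ≠ 0`.
(Heintz–Schnorr count the bad `x` in a grid by the Schwartz–Zippel bound instead, which also bounds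
the coordinates; only existence is recorded here.) [cite: HeintzSchnorr1980, Thm. 4.4 (proof)] -/
theorem evalForm_rich [Infinite K] (hmon : Function.Injective mon)
    (𝓠 : Finset (Ideal (MvPolynomial (Fin N) K)))
    (h𝓠 : ∀ 𝔮 ∈ 𝓠, ∃ v, v ≠ 0 ∧ v ∈ MvPolynomial.zeroLocus K 𝔮) :
    ∃ x : Fin n → K, ∀ 𝔮 ∈ 𝓠, evalForm mon x ∉ 𝔮 := by
  classical
  choose! w hw using h𝓠
  set p : MvPolynomial (Fin n) K := ∏ 𝔮 ∈ 𝓠, toPoly mon (w 𝔮) with hp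
  have hp0 : p ≠ 0 := by
    rw [hp, Finset.prod_ne_zero_iff]
    intro 𝔮 h𝔮 h0
    exact (hw 𝔮 h𝔮).1 ((toPoly_eq_zero_iff hmon).mp h0)
  have hx : ∃ x : Fin n → K, eval x p ≠ 0 := by
    by_contra hcon
    push Not at hcon
    exact hp0 (MvPolynomial.funext fun x => by rw [hcon x, map_zero])
  obtain ⟨x, hx⟩ := hx
  refine ⟨x, fun 𝔮 h𝔮 hmem => hx ?_⟩
  rw [hp, map_prod]
  refine Finset.prod_eq_zero h𝔮 ?_
  rw [← eval_evalForm, ← coe_aeval_eq_eval]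
  exact (hw 𝔮 h𝔮).2 _ hmem

/-- **Heintz–Schnorr existence, cone form.** For a finite family of homogeneous primes `𝔓` of the
coefficient ring `K[X_0, …, X_{N-1}]` (`K` infinite) with `dim S/𝔓 ≤ a`, there are at most `a`
points `x_1, …, x_a ∈ K^n` such that every `K`-zero `v` of some `𝔓` whose polynomial
`Σ_i v_i x^{mon i}` vanishes at all the `x_j` is `0`. [cite: HeintzSchnorr1980, Thm. 4.4] -/
theorem exists_points_kill_zeroVec [Infinite K] (hmon : Function.Injective mon) (a : ℕ)
    (𝓟 : Finset (Ideal (MvPolynomial (Fin N) K)))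
    (h𝓟 : ∀ 𝔓 ∈ 𝓟, 𝔓.IsPrime ∧ 𝔓.IsHomogeneous (homogeneousSubmodule (Fin N) K) ∧
      ringKrullDim (MvPolynomial (Fin N) K ⧸ 𝔓) ≤ a) :
    ∃ pts : Finset (Fin n → K), pts.card ≤ a ∧
      ∀ 𝔓 ∈ 𝓟, ∀ v ∈ MvPolynomial.zeroLocus K 𝔓,
        (∀ x ∈ pts, eval x (toPoly mon v) = 0) → v = 0 := by
  obtain ⟨pts, hcard, hkill⟩ := cut_family (evalForm mon) (evalForm_isHomogeneous mon)
    (evalForm_rich hmon) a 𝓟 h𝓟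
  exact ⟨pts, hcard, fun 𝔓 h𝔓 v hv hev => hkill 𝔓 h𝔓 v hv fun x hx => by
    rw [eval_evalForm]; exact hev x hx⟩

end EvalForms

/-! ## Scaling a homogeneous polynomial along `X ↦ monomial 1 (u i)` -/

section Scaling

variable {σ A : Type*} [CommRing A] [Algebra K A]

/-- `aeval (X_i ↦ u_i · T) (monomial d c) = (aeval u (monomial d c)) · T^{|d|}` in `A[T]`.
[folklore] -/
private theorem aeval_monomial_one_monomial (u : σ → A) (d : σ →₀ ℕ) (c : K) :
    aeval (fun i => Polynomial.monomial 1 (u i)) (monomial d c) =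
      Polynomial.monomial d.degree (aeval u (monomial d c)) := by
  classical
  simp only [aeval_monomial, Finsupp.prod, Polynomial.algebraMap_apply]
  have hprod : ∏ i ∈ d.support, (Polynomial.monomial 1 (u i)) ^ d i =
      Polynomial.monomial d.degree (∏ i ∈ d.support, u i ^ d i) := by
    simp only [Polynomial.monomial_pow, one_mul]
    rw [Finsupp.degree_apply]
    induction d.support using Finset.induction_on with
    | empty => simp
    | insert a s ha ih =>
      rw [Finset.prod_insert ha, Finset.prod_insert ha, Finset.sum_insert ha, ih,
        Polynomial.monomial_mul_monomial]
  rw [hprod, ← Polynomial.C_mul_X_pow_eq_monomial, ← Polynomial.C_mul_X_pow_eq_monomial, ← mul_assoc,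
    ← map_mul]

/-- **Scaling a form**: for `Q` homogeneous of degree `m`,
`aeval (X_i ↦ u_i · T) Q = (aeval u Q) · T^m`. [folklore] -/
private theorem aeval_monomial_one_of_isHomogeneous (u : σ → A) {Q : MvPolynomial σ K} {m : ℕ}
    (hQ : Q.IsHomogeneous m) :
    aeval (fun i => Polynomial.monomial 1 (u i)) Q = Polynomial.monomial m (aeval u Q) := by
  classical
  conv_lhs => rw [Q.as_sum]
  conv_rhs => rw [Q.as_sum]
  rw [map_sum, map_sum, map_sum]
  refine Finset.sum_congr rfl fun d hd => ?_
  rw [aeval_monomial_one_monomial]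
  have hdeg : d.degree = m := by
    by_contra h
    exact (mem_support_iff.mp hd) (hQ.coeff_eq_zero h)
  rw [hdeg]

end Scaling

/-! ## Classes given by generic members, their cone primes, and the border -/

section Classes

variable {n : ℕ} {ι : Type*} {J : Type*} [Fintype J]
  (𝒢 : J → MvPolynomial (Fin n) (MvPolynomial ι K))

/-- **Members of the class over a `K`-algebra `L`**: the specialisations `𝒢_j(α)` of the generic
members at parameter values `α ∈ L^ι` (e.g. `Σ^{[k]}Π^{[d]}Σ` circuits: the generic member is the
sum of products of affine forms with indeterminate coefficients) — the coefficient-generating map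
of [HS80]/[CKRST20]: "a polynomial map `Q : ℂ^m → ℂ^N` given by polynomials `{Q_e}`, such that for
each `f(x) ∈ 𝒞`, there exists an `α ∈ ℂ^m`, so that `f(x) = Σ_e Q_e(α)·x^e`", with
`Q_e = coeff_e 𝒢_j`. [cite: ChatterjeeKumarRamyaSaptharishiTengse2020, Thm. 3.2 (arXiv v4 §3.1, p. 25)] -/
def IsMember (L : Type*) [CommRing L] [Algebra K L] (g : MvPolynomial (Fin n) L) : Prop :=
  ∃ (j : J) (α : ι → L),
    g = MvPolynomial.map (aeval α : MvPolynomial ι K →ₐ[K] L).toRingHom (𝒢 j)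

/-- The coefficientwise content of `MS2021.IsEpsApprox f g` for `g` in the same number of
variables (`rename (Fin.castLE _) f = f`): each coefficient of `g` is a polynomial in `ε` with
constant term the corresponding coefficient of `f`. [folklore] -/
private theorem coeff_of_isEpsApprox {f : MvPolynomial (Fin n) K}
    {g : MvPolynomial (Fin n) (RatFunc K)} (h : MS2021.IsEpsApprox f g) (μ : Fin n →₀ ℕ) :
    ∃ p : Polynomial K,
      coeff μ g = algebraMap (Polynomial K) (RatFunc K) p ∧ p.coeff 0 = coeff μ f := by
  obtain ⟨hle, H⟩ := h
  obtain ⟨p, hp, hp0⟩ := H μ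
  refine ⟨p, hp, ?_⟩
  rw [hp0]
  have hid : (Fin.castLE hle : Fin n → Fin n) = id := by
    funext i; exact Fin.ext rfl
  rw [hid]
  exact congrArg (coeff μ) (rename_id_apply f)

open Classical in
/-- The monomials occurring in the generic members. [folklore] -/
def monSet : Finset (Fin n →₀ ℕ) := Finset.univ.biUnion fun j => (𝒢 j).support

/-- Their number `N` (the dimension of coefficient space). [folklore] -/
def monN : ℕ := (monSet 𝒢).card

/-- An enumeration of the occurring monomials. [folklore] -/
def mon (i : Fin (monN 𝒢)) : Fin n →₀ ℕ := ((monSet 𝒢).equivFin.symm i : monSet 𝒢)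

/-- The enumeration is injective. [folklore] -/
private theorem mon_injective : Function.Injective (mon 𝒢) := fun _ _ h =>
  (monSet 𝒢).equivFin.symm.injective (Subtype.ext h)

/-- The enumeration lands in `monSet`. [folklore] -/
private theorem mon_mem (i : Fin (monN 𝒢)) : mon 𝒢 i ∈ monSet 𝒢 := ((monSet 𝒢).equivFin.symm i).2

/-- The enumeration is onto `monSet`. [folklore] -/
private theorem exists_mon_eq {μ : Fin n →₀ ℕ} (hμ : μ ∈ monSet 𝒢) : ∃ i, mon 𝒢 i = μ :=
  ⟨(monSet 𝒢).equivFin ⟨μ, hμ⟩, by simp [mon]⟩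

/-- Generic members have no monomials outside `monSet`. [folklore] -/
private theorem coeff_eq_zero_of_notMem_monSet (j : J) {μ : Fin n →₀ ℕ} (hμ : μ ∉ monSet 𝒢) :
    coeff μ (𝒢 j) = 0 := by
  classical
  by_contra h
  exact hμ (Finset.mem_biUnion.mpr ⟨j, Finset.mem_univ _, mem_support_iff.mpr h⟩)

/-- **The cone map of the piece `j`**: `X_i ↦ U_{j,i}(y) · T`, where `U_{j,i}(y)` is the coefficient
of the `i`-th monomial in the generic member (the polynomial parametrisation of the coefficient
vector) and `T` an extra scaling variable. [cite: HeintzSchnorr1980, Thm. 4.4 (proof)] -/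
def coneMap (j : J) :
    MvPolynomial (Fin (monN 𝒢)) K →ₐ[K] Polynomial (MvPolynomial ι K) :=
  aeval fun i => Polynomial.monomial 1 (coeff (mon 𝒢 i) (𝒢 j))

/-- **The cone prime of the piece `j`**: the ideal of all polynomial relations among the scaled
coefficient functions — the ideal of (the cone over) "`W ⊆ ℂ^N` … the closure of the set of
coefficient vectors of `𝒞`". [cite: ChatterjeeKumarRamyaSaptharishiTengse2020, Thm. 3.2 (arXiv v4 §3.1, p. 25)] -/
def conePrime (j : J) : Ideal (MvPolynomial (Fin (monN 𝒢)) K) := RingHom.ker (coneMap 𝒢 j)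

/-- Membership in the cone prime. [folklore] -/
private theorem mem_conePrime_iff (j : J) {P : MvPolynomial (Fin (monN 𝒢)) K} :
    P ∈ conePrime 𝒢 j ↔ coneMap 𝒢 j P = 0 := RingHom.mem_ker

/-- The cone prime is prime (a kernel into a domain). [folklore] -/
private theorem conePrime_isPrime (j : J) : (conePrime 𝒢 j).IsPrime := RingHom.ker_isPrime _

/-- The cone prime is homogeneous: the cone map sends a form of degree `m` to `(·) · T^m`.
[folklore] -/
private theorem conePrime_isHomogeneous (j : J) :
    (conePrime 𝒢 j).IsHomogeneous (homogeneousSubmodule (Fin (monN 𝒢)) K) := by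
  classical
  intro m P hP
  rw [show (DirectSum.decompose (homogeneousSubmodule (Fin (monN 𝒢)) K) P m :
      MvPolynomial (Fin (monN 𝒢)) K) = homogeneousComponent m P from
      MvPolynomial.decomposition.decompose'_apply P m]
  have hP' : coneMap 𝒢 j P = 0 := (mem_conePrime_iff 𝒢 j).mp hP
  rw [mem_conePrime_iff, coneMap,
    aeval_monomial_one_of_isHomogeneous _ (homogeneousComponent_isHomogeneous m P)]
  by_cases hm : m ∈ Finset.range (P.totalDegree + 1)
  · have hsum : ∑ m' ∈ Finset.range (P.totalDegree + 1),
        Polynomial.monomial m' (aeval (fun i => coeff (mon 𝒢 i) (𝒢 j))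
          (homogeneousComponent m' P)) = 0 := by
      rw [← hP', coneMap]
      conv_rhs => rw [← sum_homogeneousComponent P]
      rw [map_sum]
      refine Finset.sum_congr rfl fun m' _ => ?_
      rw [aeval_monomial_one_of_isHomogeneous _ (homogeneousComponent_isHomogeneous m' P)]
    have hc := congrArg (fun q : Polynomial (MvPolynomial ι K) => q.coeff m) hsum
    simp only [Polynomial.finsetSum_coeff, Polynomial.coeff_monomial, Finset.sum_ite_eq',
      if_pos hm, Polynomial.coeff_zero] at hc
    rw [hc, map_zero]
  · rw [homogeneousComponent_eq_zero _ _ (by simpa using hm), map_zero, map_zero]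

/-- **`dim S/𝔓_j ≤ #ι + 1`** ("The dimension, `dim W ≤ m`" for the closure `W` of the image of an
`m`-variate coefficient-generating map; here for the cone over `W`, one more): `S/𝔓_j` embeds into
`K[y_i : i ∈ ι][T]`, so its dimension — the transcendence degree of the image (Matsumura Thm 5.6,
`Literature.RingTheory.KrullDimension.ringKrullDim_eq_toNat_trdeg_range_of_injective`) — is at
most `#ι + 1`. [cite: ChatterjeeKumarRamyaSaptharishiTengse2020, Thm. 3.2 (arXiv v4 §3.1, p. 25, first bullet)] -/
theorem ringKrullDim_quotient_conePrime_le [Fintype ι] (j : J) :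
    ringKrullDim (MvPolynomial (Fin (monN 𝒢)) K ⧸ conePrime 𝒢 j) ≤ (Fintype.card ι + 1 : ℕ) := by
  set ψ := Ideal.kerLiftAlg (coneMap 𝒢 j) with hψ
  haveI : Algebra.FiniteType K (MvPolynomial (Fin (monN 𝒢)) K ⧸ conePrime 𝒢 j) :=
    Algebra.FiniteType.of_surjective (Ideal.Quotient.mkₐ K _) (Ideal.Quotient.mkₐ_surjective K _)
  haveI : Algebra.FiniteType K ψ.range :=
    Algebra.FiniteType.of_surjective ψ.rangeRestrict ψ.rangeRestrict_surjective
  have h := Literature.RingTheory.KrullDimension.ringKrullDim_eq_toNat_trdeg_range_of_injective ψ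
    (Ideal.kerLiftAlg_injective _)
  change ringKrullDim (MvPolynomial (Fin (monN 𝒢)) K ⧸ RingHom.ker (coneMap 𝒢 j)) ≤ _
  rw [h]
  have ht : Algebra.trdeg K ψ.range ≤ (Fintype.card ι + 1 : ℕ) := by
    calc Algebra.trdeg K ψ.range
        ≤ Algebra.trdeg K (Polynomial (MvPolynomial ι K)) :=
          trdeg_le_of_injective ψ.range.val Subtype.val_injective
      _ = Algebra.trdeg K (MvPolynomial (Option ι) K) :=
          (MvPolynomial.optionEquivLeft K ι).trdeg_eq.symm
      _ = (Fintype.card ι + 1 : ℕ) := by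
          rw [MvPolynomial.trdeg_of_isDomain]
          simp [Cardinal.mk_fintype]
  have := Cardinal.toNat_le_toNat ht (Cardinal.natCast_lt_aleph0)
  rw [Cardinal.toNat_natCast] at this
  exact_mod_cast this

variable {𝒢}

omit [Fintype J] in
/-- Coefficients of a member: `coeff_μ 𝒢_j(α) = U_{j,μ}(α)`. [folklore] -/
private theorem coeff_member {L : Type*} [CommRing L] [Algebra K L] (j : J) (α : ι → L)
    (μ : Fin n →₀ ℕ) :
    coeff μ (MvPolynomial.map (aeval α : MvPolynomial ι K →ₐ[K] L).toRingHom (𝒢 j)) =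
      aeval α (coeff μ (𝒢 j)) := by
  rw [coeff_map]; rfl

/-- An `ε`-limit of a member has no monomials outside `monSet`. [folklore] -/
private theorem coeff_eq_zero_of_isEpsApprox {f : MvPolynomial (Fin n) K} {j : J}
    {α : ι → RatFunc K}
    (hfg : MS2021.IsEpsApprox f (MvPolynomial.map (aeval α).toRingHom (𝒢 j))) {μ : Fin n →₀ ℕ}
    (hμ : μ ∉ monSet 𝒢) : coeff μ f = 0 := by
  obtain ⟨p, hp, hp0⟩ := coeff_of_isEpsApprox hfg μ
  rw [coeff_member, coeff_eq_zero_of_notMem_monSet 𝒢 j hμ, map_zero] at hp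
  have : p = 0 := RatFunc.algebraMap_injective K (by rw [← hp, map_zero])
  rw [← hp0, this, Polynomial.coeff_zero]

/-- **`ε`-limits of members are `K`-zeros of the cone prime**: a relation `P(U·T) = 0` holds at
`T = 1`, `y = α(ε)`, i.e. `P(coeff g) = 0` in `K(ε)`; the coefficients lie in `K[ε]`, so `P` of the
constant terms — the coefficients of `f` — vanishes. [cite: HeintzSchnorr1980, Thm. 4.4 (proof)] -/
theorem mem_zeroLocus_conePrime_of_isEpsApprox {f : MvPolynomial (Fin n) K} {j : J}
    {α : ι → RatFunc K}
    (hfg : MS2021.IsEpsApprox f (MvPolynomial.map (aeval α).toRingHom (𝒢 j))) :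
    (fun i => coeff (mon 𝒢 i) f) ∈ MvPolynomial.zeroLocus K (conePrime 𝒢 j) := by
  classical
  intro P hP
  have hP' : coneMap 𝒢 j P = 0 := (mem_conePrime_iff 𝒢 j).mp hP
  choose q hq hq0 using coeff_of_isEpsApprox hfg
  -- specialise `T ↦ 1`, `y ↦ α`
  set Ψ : Polynomial (MvPolynomial ι K) →ₐ[K] RatFunc K :=
    Polynomial.eval₂AlgHom (aeval α) 1 fun _ => Commute.all _ _ with hΨ
  have h1 : aeval (fun i => algebraMap (Polynomial K) (RatFunc K) (q (mon 𝒢 i))) P = 0 := by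
    have h := congrArg Ψ hP'
    rw [map_zero, coneMap, comp_aeval_apply] at h
    rw [← h]
    have hfun : (fun i => algebraMap (Polynomial K) (RatFunc K) (q (mon 𝒢 i))) =
        fun i => Ψ (Polynomial.monomial 1 (coeff (mon 𝒢 i) (𝒢 j))) := by
      funext i
      rw [← hq, coeff_member, hΨ, Polynomial.eval₂AlgHom_apply, Polynomial.eval₂_monomial, pow_one,
        mul_one]
      rfl
    rw [hfun]
  -- pull back along `K[ε] → K(ε)`
  have h2 : aeval (fun i => q (mon 𝒢 i)) P = 0 := by
    apply RatFunc.algebraMap_injective K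
    rw [map_zero, ← h1,
      show algebraMap (Polynomial K) (RatFunc K) (aeval (fun i => q (mon 𝒢 i)) P) =
        (IsScalarTower.toAlgHom K (Polynomial K) (RatFunc K)) (aeval (fun i => q (mon 𝒢 i)) P)
        from rfl,
      comp_aeval_apply]
    rfl
  -- take constant coefficients
  have h3 := congrArg (Polynomial.aeval (0 : K)) h2
  rw [map_zero, comp_aeval_apply] at h3
  have hfun : (fun i => coeff (mon 𝒢 i) f) = fun i => Polynomial.aeval (0 : K) (q (mon 𝒢 i)) := by
    funext i
    rw [← hq0, Polynomial.coeff_zero_eq_aeval_zero]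
  rw [hfun]
  exact h3

/-- An `ε`-limit of a member is the polynomial of its coefficient vector on `monSet`. [folklore] -/
private theorem toPoly_coeff_eq {f : MvPolynomial (Fin n) K} (hf : ∀ μ ∉ monSet 𝒢, coeff μ f = 0) :
    toPoly (mon 𝒢) (fun i => coeff (mon 𝒢 i) f) = f := by
  classical
  ext μ
  by_cases hμ : μ ∈ monSet 𝒢
  · obtain ⟨i, rfl⟩ := exists_mon_eq 𝒢 hμ
    rw [coeff_toPoly (mon_injective 𝒢)]
  · rw [hf μ hμ, coeff_toPoly_of_notMem]
    rintro ⟨i, rfl⟩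
    exact hμ (mon_mem 𝒢 i)

variable (𝒢)

/-- **Heintz–Schnorr 1980, Thm. 4.4 (existence half), for border classes.** Let `K` be a field of
characteristic `0` and let a class of `n`-variate polynomials be given by finitely many GENERIC
MEMBERS `𝒢_j ∈ K[y_1, …, y_r][x_1, …, x_n]` — over any `K`-algebra `L` its members are the
specialisations `𝒢_j(α)`, `α ∈ L^r` (every syntactic circuit class with `r` scalars is of this
form). Then there is a set `H ⊆ K^n` of AT MOST `r + 1` points hitting every non-zero polynomial
`f ∈ K[x]` of the BORDER of the class, i.e. every `f ≠ 0` with `g = f + ε·Q ∈ 𝒞_{K(ε)}`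
(`MS2021.IsEpsApprox f g`): some `x ∈ H` has `f(x) ≠ 0`; `K` infinite (char `0` in the sources).
Printed (HS80 Thm. 4.4, for circuits of size `s` and
degree `d`, with explicit integer points): hitting sets of size polynomial in the number of
parameters exist for the Zariski closure of the class; CKRST 2020 (arXiv v4 §3.1, Thms. 3.1–3.3)
restate it for `VP` and its closure. Proof: the border lies in the `K`-zero set of the homogeneous
primes `𝔓_j` (`mem_zeroLocus_conePrime_of_isEpsApprox`), of dimension `≤ r + 1`
(`ringKrullDim_quotient_conePrime_le`), and `r + 1` evaluation forms cut every such cone down to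
`{0}` (`exists_points_kill_zeroVec`). NOT recorded: the bit-size bound on the points (HS80 choose
them in a grid of size `(sd)^{O(1)}` by counting bad points with Bézout/Schwartz–Zippel).
[cite: HeintzSchnorr1980, Thm. 4.4] -/
theorem exists_hittingSet_border [Fintype ι] [Infinite K] :
    ∃ H : Finset (Fin n → K), H.card ≤ Fintype.card ι + 1 ∧
      ∀ f : MvPolynomial (Fin n) K, f ≠ 0 →
        (∃ g, IsMember 𝒢 (RatFunc K) g ∧ MS2021.IsEpsApprox f g) → ∃ x ∈ H, eval x f ≠ 0 := by
  classical
  set 𝓟 : Finset (Ideal (MvPolynomial (Fin (monN 𝒢)) K)) := Finset.univ.image (conePrime 𝒢)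
    with h𝓟
  have h𝓟prop : ∀ 𝔓 ∈ 𝓟, 𝔓.IsPrime ∧
      𝔓.IsHomogeneous (homogeneousSubmodule (Fin (monN 𝒢)) K) ∧
      ringKrullDim (MvPolynomial (Fin (monN 𝒢)) K ⧸ 𝔓) ≤ (Fintype.card ι + 1 : ℕ) := by
    intro 𝔓 h𝔓
    obtain ⟨j, -, rfl⟩ := Finset.mem_image.mp h𝔓
    exact ⟨conePrime_isPrime 𝒢 j, conePrime_isHomogeneous 𝒢 j,
      ringKrullDim_quotient_conePrime_le 𝒢 j⟩
  obtain ⟨pts, hcard, hkill⟩ :=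
    exists_points_kill_zeroVec (mon_injective 𝒢) (Fintype.card ι + 1) 𝓟 h𝓟prop
  refine ⟨pts, hcard, ?_⟩
  rintro f hf0 ⟨g, ⟨j, α, rfl⟩, hfg⟩
  by_contra hcon
  push Not at hcon
  have hsupp : ∀ μ ∉ monSet 𝒢, coeff μ f = 0 := fun μ hμ => coeff_eq_zero_of_isEpsApprox hfg hμ
  have hv := hkill (conePrime 𝒢 j) (Finset.mem_image.mpr ⟨j, Finset.mem_univ _, rfl⟩)
    (fun i => coeff (mon 𝒢 i) f) (mem_zeroLocus_conePrime_of_isEpsApprox hfg)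
    (fun x hx => by rw [toPoly_coeff_eq hsupp]; exact hcon x hx)
  apply hf0
  rw [← toPoly_coeff_eq hsupp, hv]
  exact (toPoly_eq_zero_iff (mon_injective 𝒢)).mpr rfl

/-! ## The Zariski closure of the members (Heintz–Schnorr's `W = closure of im Q`, verbatim) -/

variable {𝒢}

/-- A relation of the cone prime holds at every member over `K`: `P ∈ 𝔓_j` means `P(Q_j(y)·T) = 0`
identically, hence `P(coeff 𝒢_j(β)) = 0` at `T = 1`, `y = β ∈ K^ι`. [folklore] -/
private theorem aeval_coeff_member_eq_zero_of_mem_conePrime {j : J}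
    {P : MvPolynomial (Fin (monN 𝒢)) K} (hP : P ∈ conePrime 𝒢 j) (β : ι → K) :
    aeval (fun i => coeff (mon 𝒢 i)
      (MvPolynomial.map (aeval β : MvPolynomial ι K →ₐ[K] K).toRingHom (𝒢 j))) P = 0 := by
  classical
  have hP' : coneMap 𝒢 j P = 0 := (mem_conePrime_iff 𝒢 j).mp hP
  set Ψ : Polynomial (MvPolynomial ι K) →ₐ[K] K :=
    Polynomial.eval₂AlgHom (aeval β) 1 fun _ => Commute.all _ _ with hΨ
  have h := congrArg Ψ hP'
  rw [map_zero, coneMap, comp_aeval_apply] at h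
  rw [← h]
  have hfun : (fun i => coeff (mon 𝒢 i)
      (MvPolynomial.map (aeval β : MvPolynomial ι K →ₐ[K] K).toRingHom (𝒢 j))) =
      fun i => Ψ (Polynomial.monomial 1 (coeff (mon 𝒢 i) (𝒢 j))) := by
    funext i
    rw [coeff_member, hΨ, Polynomial.eval₂AlgHom_apply, Polynomial.eval₂_monomial, pow_one,
      mul_one]
    rfl
  rw [hfun]

/-- **Points of the Zariski closure of the members are `K`-zeros of the cone prime.** If the
coefficient vector of `f` lies in the Zariski closure of the coefficient vectors of the members
`𝒢_j(β)`, `β ∈ K^ι`, of the piece `j`, then `(coeff_e f)_e ∈ V_K(𝔓_j)`: a relation `P ∈ 𝔓_j`,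
read in the coefficient coordinates (`rename mon P`), vanishes on the members
(`aeval_coeff_member_eq_zero_of_mem_conePrime`), hence on their closure ("`W` … the closure of the
set of coefficient vectors of `𝒞`" IS cut out by these relations at `T = 1`).
[cite: ChatterjeeKumarRamyaSaptharishiTengse2020, Thm. 3.2 (arXiv v4 §3.1, p. 25)] -/
theorem mem_zeroLocus_conePrime_of_mem_zariskiClosure {f : MvPolynomial (Fin n) K} {j : J}
    (hf : coeffVec f ∈ zariskiClosure (coeffVec ''
      {g : MvPolynomial (Fin n) K | ∃ β : ι → K,
        g = MvPolynomial.map (aeval β : MvPolynomial ι K →ₐ[K] K).toRingHom (𝒢 j)})) :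
    (fun i => coeff (mon 𝒢 i) f) ∈ MvPolynomial.zeroLocus K (conePrime 𝒢 j) := by
  classical
  intro P hP
  have h := (mem_zariskiClosure_iff.mp hf) (rename (mon 𝒢) P) ?_
  · rw [aeval_rename] at h
    exact h
  · rintro _ ⟨g, ⟨β, rfl⟩, rfl⟩
    rw [aeval_rename]
    exact aeval_coeff_member_eq_zero_of_mem_conePrime hP β

/-- Off `monSet` the coefficients of a point of the closure of the piece `j` vanish (the coordinate
function `X_μ` vanishes on the members). [folklore] -/
private theorem coeff_eq_zero_of_mem_zariskiClosure {f : MvPolynomial (Fin n) K} {j : J}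
    (hf : coeffVec f ∈ zariskiClosure (coeffVec ''
      {g : MvPolynomial (Fin n) K | ∃ β : ι → K,
        g = MvPolynomial.map (aeval β : MvPolynomial ι K →ₐ[K] K).toRingHom (𝒢 j)}))
    {μ : Fin n →₀ ℕ} (hμ : μ ∉ monSet 𝒢) : coeff μ f = 0 := by
  have h := (mem_zariskiClosure_iff.mp hf) (X μ) ?_
  · rwa [aeval_X, coeffVec_apply] at h
  · rintro _ ⟨g, ⟨β, rfl⟩, rfl⟩
    rw [aeval_X, coeffVec_apply, coeff_member, coeff_eq_zero_of_notMem_monSet 𝒢 j hμ, map_zero]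

/-- A point of the Zariski closure of ALL the members over `K` lies in the closure of the members
of ONE piece: the members are the finite union of the pieces, and the Zariski closure of a finite
union is the union of the closures (if `x ∉ \overline{A_j}` for every `j`, the product of the
separating test polynomials separates `x` from `⋃_j A_j`; Hartshorne I, Prop. 1.1). [folklore] -/
private theorem exists_piece_of_mem_zariskiClosure {f : MvPolynomial (Fin n) K}
    (hf : coeffVec f ∈ zariskiClosure (coeffVec '' {g | IsMember 𝒢 K g})) :
    ∃ j : J, coeffVec f ∈ zariskiClosure (coeffVec ''
      {g : MvPolynomial (Fin n) K | ∃ β : ι → K,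
        g = MvPolynomial.map (aeval β : MvPolynomial ι K →ₐ[K] K).toRingHom (𝒢 j)}) := by
  classical
  by_contra hcon
  push Not at hcon
  have hsep : ∀ j : J, ∃ p : MvPolynomial (Fin n →₀ ℕ) K,
      (∀ y ∈ coeffVec '' {g : MvPolynomial (Fin n) K | ∃ β : ι → K,
          g = MvPolynomial.map (aeval β : MvPolynomial ι K →ₐ[K] K).toRingHom (𝒢 j)},
        aeval y p = 0) ∧ aeval (coeffVec f) p ≠ 0 := by
    intro j
    have hj := hcon j
    rw [mem_zariskiClosure_iff] at hj
    push Not at hj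
    exact hj
  choose p hp0 hpx using hsep
  have h := (mem_zariskiClosure_iff.mp hf) (∏ j, p j) ?_
  · rw [map_prod] at h
    exact Finset.prod_ne_zero_iff.mpr (fun j _ => hpx j) h
  · rintro _ ⟨g, ⟨j, β, rfl⟩, rfl⟩
    rw [map_prod]
    exact Finset.prod_eq_zero (Finset.mem_univ j) (hp0 j _ ⟨_, ⟨β, rfl⟩, rfl⟩)

variable (𝒢)

/-- **Heintz–Schnorr 1980, Thm. 4.4 (existence half) — for the ZARISKI CLOSURE, verbatim.** Let
`K` be an infinite field and let a class of `n`-variate polynomials be given by finitely many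
generic members `𝒢_j ∈ K[y_1, …, y_r][x_1, …, x_n]`. Let `W` be the Zariski closure, in
coefficient space, of the coefficient vectors of the members `𝒢_j(β)`, `β ∈ K^r`
(`zariskiClosure (coeffVec '' {g | IsMember 𝒢 K g})`; [CKRST20, Thm. 3.2]: "for `W ⊆ ℂ^N` being
the closure of the set of coefficient vectors of `𝒞`"; [HS80, Thm. 4.4]: `W(n,s,d)` = the Zariski
closure of the easy polynomials). Then there is a set `H ⊆ K^n` of AT MOST `r + 1` points such that
every non-zero `f ∈ K[x]` with `coeff f ∈ W` has `f(x) ≠ 0` for some `x ∈ H`. Printed: "for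
`t = 10·dim(W)`, there exists a set of `t` points `{a_1, …, a_t} ⊆ [b]^n` that is a hitting set"
(the proof, CKRST p. 26, runs for `W`); here `dim W ≤ r`, `r + 1` points, coordinates unbounded
(NOT recorded: the coordinate bound `[b]^n`, which needs Bézout). Proof: `W ⊆ ⋃_j V_K(𝔓_j)`
(`exists_piece_of_mem_zariskiClosure`, `mem_zeroLocus_conePrime_of_mem_zariskiClosure`), and the
points of `exists_points_kill_zeroVec` kill every `K`-zero of every cone prime `𝔓_j`.
[cite: HeintzSchnorr1980, Thm. 4.4; ChatterjeeKumarRamyaSaptharishiTengse2020, Thms. 3.2–3.3 (arXiv v4 §3.1, pp. 25–26)] -/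
theorem exists_hittingSet_zariskiClosure [Fintype ι] [Infinite K] :
    ∃ H : Finset (Fin n → K), H.card ≤ Fintype.card ι + 1 ∧
      ∀ f : MvPolynomial (Fin n) K, f ≠ 0 →
        coeffVec f ∈ zariskiClosure (coeffVec '' {g | IsMember 𝒢 K g}) →
          ∃ x ∈ H, eval x f ≠ 0 := by
  classical
  set 𝓟 : Finset (Ideal (MvPolynomial (Fin (monN 𝒢)) K)) := Finset.univ.image (conePrime 𝒢)
    with h𝓟
  have h𝓟prop : ∀ 𝔓 ∈ 𝓟, 𝔓.IsPrime ∧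
      𝔓.IsHomogeneous (homogeneousSubmodule (Fin (monN 𝒢)) K) ∧
      ringKrullDim (MvPolynomial (Fin (monN 𝒢)) K ⧸ 𝔓) ≤ (Fintype.card ι + 1 : ℕ) := by
    intro 𝔓 h𝔓
    obtain ⟨j, -, rfl⟩ := Finset.mem_image.mp h𝔓
    exact ⟨conePrime_isPrime 𝒢 j, conePrime_isHomogeneous 𝒢 j,
      ringKrullDim_quotient_conePrime_le 𝒢 j⟩
  obtain ⟨pts, hcard, hkill⟩ :=
    exists_points_kill_zeroVec (mon_injective 𝒢) (Fintype.card ι + 1) 𝓟 h𝓟prop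
  refine ⟨pts, hcard, ?_⟩
  intro f hf0 hf
  obtain ⟨j, hj⟩ := exists_piece_of_mem_zariskiClosure hf
  by_contra hcon
  push Not at hcon
  have hsupp : ∀ μ ∉ monSet 𝒢, coeff μ f = 0 := fun μ hμ =>
    coeff_eq_zero_of_mem_zariskiClosure hj hμ
  have hv := hkill (conePrime 𝒢 j) (Finset.mem_image.mpr ⟨j, Finset.mem_univ _, rfl⟩)
    (fun i => coeff (mon 𝒢 i) f) (mem_zeroLocus_conePrime_of_mem_zariskiClosure hj)
    (fun x hx => by rw [toPoly_coeff_eq hsupp]; exact hcon x hx)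
  apply hf0
  rw [← toPoly_coeff_eq hsupp, hv]
  exact (toPoly_eq_zero_iff (mon_injective 𝒢)).mpr rfl

/-- The same as a hitting set (`HittingSets.IsHittingSetFor`) for the class of polynomials whose
coefficient vector lies in the Zariski closure `W` of the members.
[cite: HeintzSchnorr1980, Thm. 4.4] -/
theorem isHittingSetFor_zariskiClosure [Fintype ι] [Infinite K] :
    ∃ H : Finset (Fin n → K), H.card ≤ Fintype.card ι + 1 ∧
      HittingSets.IsHittingSetFor (↑H : Set (Fin n → K))
        {f : MvPolynomial (Fin n) K |
          coeffVec f ∈ zariskiClosure (coeffVec '' {g | IsMember 𝒢 K g})} := by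
  obtain ⟨H, hcard, hH⟩ := exists_hittingSet_zariskiClosure 𝒢
  exact ⟨H, hcard, fun f hf hf0 => hH f hf0 hf⟩

end Classes

end BorderHittingSets

end Literature.Computability.AlgebraicComplexity

end
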